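import Summits.CriticalPhenomena.CardyFormulaZ2.Theorems.CardyComplexConeDefs
import Summits.CriticalPhenomena.CardyFormulaZ2.Theorems.CardyComplexConeEdgePrecompactTranslationCovariance
import Summits.CriticalPhenomena.CardyFormulaZ2.Theorems.CardySelfRefinementLagHandOffRotationData
import Literature.Probability.LatticeModels.MedialWindingBridge

/-!
# Stub `stub_coherenceShift` of line `finitary-green-pairing`
(crux `CoherentMorera`, stmt-CriticalPhenomena-11388)

**Coherence shift = exact quarter-turn covariance + universality.** If a class vector `u` makes the
corner observable of EVERY guarded family of every Jordan Dobrushin domain coherent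
(`EdgeCoherenceWith u`), then so does `u ∘ classShift`, where `classShift o = R o − e₀` is the action
of the quarter turn `R (a, b) = (−b, a)` on corner classes (faces re-indexed by their new lower-left
corner).

Proof.
1. *Exact covariance of the corner observable* (`cornerObs_rot`): for ℤ²-admissible data `E` and the
   turned data `E'` (`E'.Ω = i·E.Ω`, same mesh, `E'.arcA = i·E.arcA`, `E'.arcB = i·E.arcB`) and every
   corner `(v, f)`, `cornerObs E' δ (R v) (R f − e₀) = cornerObs E δ v f`. Measure step: `P_{1/2}` on
   `ℤ²` is invariant under the relabelling `ω ↦ R ω` (`bondPercolation_map_relabel_iso` with the graph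
   automorphism `rotCell`; Grimmett 1999 §1.6), `integral_map_equiv`. Pointwise step: the exploration
   of the turned data in the turned configuration is the turned exploration
   (`medialExploration_rot`: the predicate `IsMedialExploration` is transported by the tree's
   quarter-turn dictionary of `…CardySelfRefinementLagHandOffRotationCorners/…RotationData` —
   corners, `cornerSource`/`cornerTarget` (orientation is preserved), inner faces, arcs, `A`–`B`
   edges, boundary conditions, the turning rule — and pinned down by uniqueness,
   `existsUnique_medialExploration_holds`, admissibility being transported by `isZdAdmissible_rot`);
   the turned corner has turned source/target, medial points turn rigidly (`medialPoint_rot`) and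
   the polyline winding is invariant under `z ↦ i z` (`winding_map_mul_I`; Smirnov 2010 §2.2).
2. *Universality*: given `u`, `EdgeCoherenceWith u` and a guarded family `Λ` of `D`, apply the
   hypothesis to the turned domain `D.map (z ↦ i z)` and the turned family; its guards and the compact
   `i·K` are the turned ones. For a corner `(v, f)` with `δv ∈ K` the turned corner `(R v, R f − e₀)`
   has `δ R v = i δv ∈ i·K` and class `(R f' − e₀) − R v = classShift (f' − v)`, so by step 1 the
   delivered inequality is literally the claimed one (eventually in `δ`, on the admissible range).
References: S. Smirnov, Ann. of Math. 172 (2010), §2.2; H. Duminil-Copin, S. Smirnov, Clay Math.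
Proc. 15 (2012), §8; G. Grimmett, *Percolation* (1999), §1.6.
-/

namespace Summit.CriticalPhenomena.CardyFormulaZ2.Cruxes.CoherentMorera.FinitaryGreenPairing

open MeasureTheory Filter Set Metric
open scoped Topology BigOperators
open Literature.Probability.LatticeModels Literature.Probability.Percolation
open Literature.Probability.RandomPlanarGeometry (DobrushinDomain MarkedDomain)
open Summit.CriticalPhenomena.CardyFormulaZ2.Cruxes.EdgePrecompact
open Summit.CriticalPhenomena.CardyFormulaZ2.Cruxes.LagHandOff.HittingTournament
  (isCorner_rot_iff cornerSource_rot cornerTarget_rot isMedialTurn_rot_iff isMedialStep_rot_iff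
    bcBondConfig_rot mem_zdArcA_rot_iff rot_mem_zdABEdges_iff isZdAdmissible_rot rot_face_apply
    meshPoint_rotCell)

noncomputable section

namespace CoherenceShift

/-! ## The exploration path of the turned data -/

section Data

variable {E E' : DiscreteDobrushin}
  (hΩ : E'.Ω = (fun z => Complex.I * z) '' E.Ω) (hδ : E'.δ = E.δ)
  (hA : E'.arcA = (fun z => Complex.I * z) '' E.arcA)
  (hB : E'.arcB = (fun z => Complex.I * z) '' E.arcB)
include hΩ hδ hA hB

/-- **Transport of structure.** The turned exploration path of `ω` in `E` is an exploration path of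
the turned configuration in the turned data (adapted from `isMedialExploration_shiftData_map` of
`…EdgePrecompactMedialExplorationShiftData`, with the quarter-turn dictionary of
`…LagHandOffRotationCorners/…RotationData`). -/
theorem isMedialExploration_rot_map {ω : BondConfig (Site 2)} {γ : List MedialVertex}
    (h : IsMedialExploration E ω γ) :
    IsMedialExploration E' (BondConfig.relabel (sym2Equiv rotCell) ω) (γ.map (sym2Equiv rotCell)) := by
  have hback : ∀ l : List MedialVertex,
      (l.map (sym2Equiv rotCell)).map (sym2Equiv rotCell).symm = l := fun l => by
    rw [List.map_map, Equiv.symm_comp_self, List.map_id]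
  have hne : γ.map (sym2Equiv rotCell) ≠ [] := by simpa using h.ne_nil
  refine ⟨hne, ?_, ?_, ?_, ?_, ?_, ?_, ?_⟩
  · intro e e' hinf
    have h2 := hinf.map (sym2Equiv rotCell).symm
    rw [hback] at h2
    have := (isMedialStep_rot_iff hΩ hδ _ _).2 (h.step _ _ h2)
    simpa only [Equiv.apply_symm_apply] using this
  · intro e₀ e₁ e₂ hinf
    have h2 := hinf.map (sym2Equiv rotCell).symm
    rw [hback] at h2
    have := (isMedialTurn_rot_iff (E.bcBondConfig ω) _ _ _).2 (h.turn _ _ _ h2)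
    rw [← bcBondConfig_rot hΩ hδ hA hB] at this
    simpa only [Equiv.apply_symm_apply] using this
  · rw [← List.map_tail, List.zip_map]
    exact h.nodup.map ((sym2Equiv _).injective.prodMap (sym2Equiv _).injective)
  · rw [List.head_map]
    exact (rot_mem_zdABEdges_iff hΩ hδ hA hB _).2 h.head_mem
  · rw [List.getLast_map]
    exact (rot_mem_zdABEdges_iff hΩ hδ hA hB _).2 h.getLast_mem
  · rw [List.head_map, List.getLast_map]
    exact fun heq => h.head_ne_getLast ((sym2Equiv _).injective heq)
  · intro e e' hpre
    have h2 := hpre.map (sym2Equiv rotCell).symm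
    rw [hback] at h2
    obtain ⟨v, f, hc, hs, ht, hvA⟩ := h.start _ _ h2
    refine ⟨rotCell v, CellSymmetry.rot.face f, (isCorner_rot_iff v f).2 hc, ?_, ?_,
      (mem_zdArcA_rot_iff hΩ hδ hA v).2 hvA⟩
    · rw [cornerSource_rot hc, hs]; exact Equiv.apply_symm_apply _ _
    · rw [cornerTarget_rot hc, ht]; exact Equiv.apply_symm_apply _ _

/-- **Quarter-turn covariance of the medial exploration path**: for admissible data, exploring the
turned data in the turned configuration gives the turned path (both data are admissible, so both
explorations are THE unique ones, `existsUnique_medialExploration_holds`). -/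
theorem medialExploration_rot (hE : E.IsZdAdmissible) (ω : BondConfig (Site 2)) :
    medialExploration E' (BondConfig.relabel (sym2Equiv rotCell) ω) =
      (medialExploration E ω).map (sym2Equiv rotCell) := by
  have hE' := isZdAdmissible_rot hΩ hδ hA hB hE
  obtain ⟨γ', -, huniq⟩ :=
    existsUnique_medialExploration_holds E' hE' (BondConfig.relabel (sym2Equiv rotCell) ω)
  rw [huniq _ (isMedialExploration_medialExploration_holds E' hE' _), huniq _
    (isMedialExploration_rot_map hΩ hδ hA hB (isMedialExploration_medialExploration_holds E hE ω))]

end Data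

/-! ## Medial points turn rigidly, windings are unchanged, `P_{1/2}` is invariant -/

/-- The medial point of a turned medial vertex is the turned medial point. -/
theorem medialPoint_rot (δ : ℝ) (e : MedialVertex) :
    medialPoint δ (sym2Equiv rotCell e) = Complex.I * medialPoint δ e := by
  induction e using Sym2.ind with
  | h x y =>
    rw [sym2Equiv_mk, medialPoint_mk, medialPoint_mk, meshPoint_rotCell, meshPoint_rotCell,
      CellSymmetry.rot_plane_apply, CellSymmetry.rot_plane_apply]
    ring

/-- The turning angle is invariant under `z ↦ i z`. -/
theorem turning_mul_I (z₁ z₂ z₃ : ℂ) :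
    Polyline.turning (Complex.I * z₁) (Complex.I * z₂) (Complex.I * z₃) = Polyline.turning z₁ z₂ z₃ := by
  rw [Polyline.turning, Polyline.turning, ← mul_sub, ← mul_sub, mul_div_mul_left _ _ Complex.I_ne_zero]

/-- The polyline winding is invariant under `z ↦ i z` (Smirnov 2010, §2.2: the winding is the total
turning of the tangent). -/
theorem winding_map_mul_I : ∀ l : List ℂ,
    Polyline.winding (l.map fun z => Complex.I * z) = Polyline.winding l
  | [] => rfl
  | [_] => rfl
  | [_, _] => rfl
  | z₁ :: z₂ :: z₃ :: zs => by
    have ih := winding_map_mul_I (z₂ :: z₃ :: zs)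
    simp only [List.map_cons] at ih ⊢
    rw [Polyline.winding_cons_cons_cons, Polyline.winding_cons_cons_cons, ih, turning_mul_I]

/-- The winding read along (a prefix of) a turned medial path equals the winding along the path. -/
theorem winding_take_map_rot (δ : ℝ) (γ : List MedialVertex) (n : ℕ) :
    Polyline.winding (((γ.map (sym2Equiv rotCell)).map (medialPoint δ)).take n) =
      Polyline.winding ((γ.map (medialPoint δ)).take n) := by
  rw [List.map_map, show medialPoint δ ∘ (sym2Equiv rotCell) = (fun z => Complex.I * z) ∘ medialPoint δ
    from funext (medialPoint_rot δ), ← List.map_map, ← List.map_take, winding_map_mul_I]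

/-- **Quarter-turn invariance of bond percolation on `ℤ²`** at `p = 1/2` (the quarter turn
`rotCell` is a graph automorphism of `ℤ²`; Grimmett 1999, §1.6). -/
theorem bondPercolation_map_rot :
    (bondPercolation (zdGraph 2) half).map (BondConfig.relabel (sym2Equiv rotCell)) =
      bondPercolation (zdGraph 2) half :=
  bondPercolation_map_relabel_iso (G := zdGraph 2) (G' := zdGraph 2)
    { toEquiv := rotCell, map_rel_iff' := fun {a b} => CellSymmetry.rot.zdGraph_adj_cell a b } half

/-! ## Exact covariance of the corner observable -/

/-- **Exact quarter-turn covariance of the corner observable**: for admissible data `E`, turned data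
`E'` and a corner `(v, f)`, `cornerObs E' δ (R v) (R f − e₀) = cornerObs E δ v f`. -/
theorem cornerObs_rot {E E' : DiscreteDobrushin} (hΩ : E'.Ω = (fun z => Complex.I * z) '' E.Ω)
    (hδ : E'.δ = E.δ) (hA : E'.arcA = (fun z => Complex.I * z) '' E.arcA)
    (hB : E'.arcB = (fun z => Complex.I * z) '' E.arcB) (hE : E.IsZdAdmissible) (δ : ℝ)
    {v f : Site 2} (hvf : IsCorner v f) :
    QkzStripBoundaryArm.cornerObs E' δ (rotCell v) (CellSymmetry.rot.face f) =
      QkzStripBoundaryArm.cornerObs E δ v f := by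
  unfold QkzStripBoundaryArm.cornerObs
  conv_lhs => rw [← bondPercolation_map_rot]
  rw [integral_map_equiv]
  refine integral_congr_ae (Eventually.of_forall fun ω => ?_)
  simp only []
  rw [medialExploration_rot hΩ hδ hA hB hE ω]
  simp only [List.length_map, List.getElem?_map, cornerSource_rot hvf, cornerTarget_rot hvf,
    QkzStripBoundaryArm.option_map_eq_some_apply_iff (sym2Equiv rotCell).injective,
    ← Literature.Probability.LatticeModels.Polyline.winding_eq_winding', -- buildfix 2026-08-20: two copies
    winding_take_map_rot]

/-- The class of the turned corner: `(R f − e₀) − R v = classShift (f − v)`. -/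
theorem rot_face_sub_rotCell (v f : Site 2) :
    CellSymmetry.rot.face f - rotCell v = classShift (f - v) := by
  rw [rot_face_apply]
  ext i
  fin_cases i
  · simp [classShift, e0]
    ring
  · simp [classShift, e0]

end CoherenceShift

open CoherenceShift in
/-- **`stub_coherenceShift`** (coherence shift: exact quarter-turn covariance + universality). If
`u` is a coherence vector for the corner observables of all guarded families of all Jordan
Dobrushin domains, then so is `u ∘ classShift`: apply the hypothesis to the turned domain
`i·D` and the turned family, and pull the inequality back along the exact covariance
`cornerObs_rot`; the turned corner `(R v, R f − e₀)` of `(v, f)` has class `classShift (f − v)`. -/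
theorem stub_coherenceShift : Sig.stub_coherenceShift := by
  intro u hu D Λ hΩ hδ hadm E K hK hKD ε hε
  -- the turned domain, family and compact
  have hI : Complex.I ≠ 0 := Complex.I_ne_zero
  have hΩ' : ∀ δ, (⟨(fun z => Complex.I * z) '' (Λ δ).Ω, (Λ δ).δ, (fun z => Complex.I * z) '' (Λ δ).arcA,
      (fun z => Complex.I * z) '' (Λ δ).arcB⟩ : DiscreteDobrushin).Ω =
      (D.map (Homeomorph.mulLeft₀ Complex.I hI)).carrier := fun δ => by
    rw [MarkedDomain.carrier_map, Homeomorph.coe_mulLeft₀, hΩ δ]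
  have hK' : IsCompact ((fun z => Complex.I * z) '' K) := hK.image (continuous_const_mul Complex.I)
  have hK'D : (fun z => Complex.I * z) '' K ⊆ (D.map (Homeomorph.mulLeft₀ Complex.I hI)).carrier := by
    rw [MarkedDomain.carrier_map, Homeomorph.coe_mulLeft₀]
    exact image_mono hKD
  have h := hu (D.map (Homeomorph.mulLeft₀ Complex.I hI)) (fun δ => ⟨(fun z => Complex.I * z) '' (Λ δ).Ω,
    (Λ δ).δ, (fun z => Complex.I * z) '' (Λ δ).arcA, (fun z => Complex.I * z) '' (Λ δ).arcB⟩) hΩ'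
    (fun δ => hδ δ) (hadm.mono fun δ hδa => isZdAdmissible_rot rfl rfl rfl rfl hδa) _ hK' hK'D ε hε
  filter_upwards [h, hadm] with δ hδu hδa v f f' hvf hvf' hvK
  have h1 := hδu (rotCell v) (CellSymmetry.rot.face f) (CellSymmetry.rot.face f')
    ((isCorner_rot_iff v f).2 hvf) ((isCorner_rot_iff v f').2 hvf')
    (by rw [meshPoint_rotCell, CellSymmetry.rot_plane_apply]; exact mem_image_of_mem _ hvK)
  rw [rot_face_sub_rotCell, rot_face_sub_rotCell] at h1
  change ‖u (classShift (f' - v)) * QkzStripBoundaryArm.cornerObs _ δ (rotCell v) (CellSymmetry.rot.face f) -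
    u (classShift (f - v)) * QkzStripBoundaryArm.cornerObs _ δ (rotCell v) (CellSymmetry.rot.face f')‖ ≤
    ε * δ ^ ((1:ℝ) / 3) at h1
  rw [cornerObs_rot (E := Λ δ) (E' := ⟨(fun z => Complex.I * z) '' (Λ δ).Ω, (Λ δ).δ,
      (fun z => Complex.I * z) '' (Λ δ).arcA, (fun z => Complex.I * z) '' (Λ δ).arcB⟩) rfl rfl rfl rfl
      hδa δ hvf, cornerObs_rot (E := Λ δ) (E' := ⟨(fun z => Complex.I * z) '' (Λ δ).Ω, (Λ δ).δ,
      (fun z => Complex.I * z) '' (Λ δ).arcA, (fun z => Complex.I * z) '' (Λ δ).arcB⟩) rfl rfl rfl rfl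
      hδa δ hvf'] at h1
  exact h1

end

end Summit.CriticalPhenomena.CardyFormulaZ2.Cruxes.CoherentMorera.FinitaryGreenPairing
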